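/-
Copyright (c) 2026 the pub-hodgecm-mathlib formalisation cell (harness21).  Prover seat hodgecm-mathlib-F0P3-p01 (g33), Track A «(D-RAM) FOUR-FRAME», unit U2H, census leaf
(ρ2b′-X) — socket (B) of LH4-p14's pay line (lead LH4-p07 (g7), (B-2)): THE T5b × T5s WELD ON TYPE RamK.  2026-09-04.
-/
import Summits.HodgeConjecture.HodgeConjecture.Theorems.F0P3cDyRamToricLevelCensusRamKTopValue     -- (this seat) (D3) row in `hvTop` value form; brings part 1, ★ g32 (D3), ★ p08 `token_kappa`
import Summits.HodgeConjecture.HodgeConjecture.Theorems.F0P3cDyRamToricLevelCensusRamKAtThirdField  -- ★ p857929 (LH4-p07 (g7)): `exists_thirdFieldPackage_ramK`; brings ★ (S3)(S4) heads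
import Summits.HodgeConjecture.HodgeConjecture.Theorems.F0P3cDyRamToricCensusSumRamK              -- ★ p857635 (LH4-p04 (g4)) T5s `toricCensusSum_ramK`
import HarnessLib

/-!
# T5b × T5s, type RamK: THE WELD — `ε·Σ_{j ≤ jλ} Σ_a q^a (#levelSetDep_h(j,a;μ) − #levelSetDep_{h′}(j,a;μ)) = q^m·(2[(jλ−d)∕2+1]_q − 2[d − d%2]_q)`

`Summits/HodgeConjecture/HodgeConjecture/Theorems/F0P3cDyRamToricCensusSumRamKWeld.lean`, namespace
`Summit.HodgeConjecture.HodgeConjecture.Cruxes.H413.F0P3cDyRamToricLevelCensusRamK`.  PROOF FILE of a SUPPORT organ (`--supports stmt-HodgeConjecture-24833 --as helper`;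
hodgecm-mathlib-F0P3-p01 (g33); socket (B) of the (ρ2b′-X) pay line, lead LH4-p07 (g7): «(B-2) WELD = F0P3-p01 (g33)»).  THEOREMS ONLY (no `def`, no instance, no notation, no sorry).

★ T5s `toricCensusSum_ramK` (LH4-p04 (g4)) is the census-sum identity over ABSTRACT tables `nP nM vP vM : ℕ → ℕ → ℚ` constrained by five hypotheses (`hnP hnM hvGen hvOff
hvTop`) and the token-side facts (`hq hd hjl hjlS hpar hmS hm hε`).  THIS FILE substitutes the ★ T5b counts of this lineage — `nP j a := #levelSet_h(j,a)` (h HYPERBOLIC, ★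
`ncard_levelSet_ramK_hyper` p857773), `nM := #levelSet_{h′}` (h′ ANISOTROPIC, ★ `ncard_levelSet_ramK_aniso` p857813), `vP∕vM j a := #levelSetDep(j,a; λ − u)` for `j ≤ jλ`
(★ `…UnrDep` (D0)(D1)(D2), type-free M∕E-unramified letters; the (D3) top row ★ `ncard_levelSetDep_top_ramK_eq` of part 2 with `S := (ε = 1)`) — and discharges all of them,
leaving ONE theorem in ONE-FIELD socket-(B) currency: the frame of ★ p857929 `exists_thirdFieldPackage_ramK` (`hρρ hvρ hΘρ hα1 hα hD hρϖ hq hσres hram`; the third field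
`K′` is obtained INSIDE), the two line models, the token `μ = λ − u`, the token-side facts of ★ p857635 that the frame does NOT imply (`2 ≤ d`, `3d ≤ jλ + 2 + 2(d%2)`,
`m ≡ d (2)`, `d − d%2 ≤ m + 1`) — `jλ ≡ d (2)` (★ part 2 `mod_two_eq_of_v_sub_map_eq`), `m ≤ jλ` (★ `token_kappa`), `2 ≤ q` are DERIVED —, and ONE side letter:
`ε ∈ {±1}` agrees with the hyperbolic bit `BIT(h, μ, c₀)` at SOME far depth `c₀` (`2d ≤ c₀ + 1`, `c₀ + d ≤ jλ + 1`) whenever far cells exist (`3d ≤ jλ + 2`).  The `ε = −1`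
window `jλ + 2 ≤ m + 2d` of ★ p857635 is DERIVED (§1 `add_le_of_not_topBit_far`: ★ p857848 §2 after the translator).
* §1 BIT-letter lemmas in the two-field frame: `topBit_or_topBit_of_le` (at a depth `c ≤ D` one of the two line models is alive) and `add_le_of_not_topBit_far` (the window).
* §2 **`toricCensusSum_ramK_weld`** — THE WELD.
HONEST LABEL: HC_CM is proved only modulo the 7 printed citations (2 remaining named inputs: hLiu418 = stmt-HodgeConjecture-24832,
h413 = stmt-HodgeConjecture-24833) until rung 0 closes; (ρ2b′-X) :418 is an OPEN prover target — this file is a helper (`--supports`), proofs only.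

## References
* [Kottwitz1986BaseChangeUnits] R. E. Kottwitz, *Base change for unit elements of Hecke algebras*, Compositio Math. 60 (1986): §1 pp. 240–241.
* [Rogawski1990] J. D. Rogawski, *Automorphic Representations of Unitary Groups in Three Variables*, Ann. of Math. Stud. 123 (1990): §4.9 Prop. 4.9.1 (b) p. 55, Lemma 4.9.3 p. 56.
* [Flicker1998UnitaryFL] Y. Z. Flicker, *Elementary proof of the fundamental lemma for a unitary group*, Canad. J. Math. 50 (1998): Prop. 7 p. 84.
* [Serre1979] J.-P. Serre, *Local Fields*, GTM 67 (1979): Ch. V §3 Prop. 5, Cor. 3.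
-/

set_option autoImplicit false

namespace Summit.HodgeConjecture.HodgeConjecture.Cruxes.H413.F0P3cDyRamToricLevelCensusRamK

open WithZero IsLocalRing Finset
open scoped Valued
open Literature.NumberTheory.Automorphic.UnitaryThreeFourFrame (IsRamifiedQuadraticDatum)
open Literature.NumberTheory.LocalFields.QuadraticOrder (exists_eq_varpi_zpow_mul_unit v_varpi_zpow exists_unit_twist_eq_of_isotropic)
open Literature.NumberTheory.LocalFields.WildQuadraticDatum
open Summit.HodgeConjecture.HodgeConjecture.Cruxes.H413.F0P3cDyRamToricCensusDefs
open Summit.HodgeConjecture.HodgeConjecture.Cruxes.H413.F0P3cDyRamToricLevelCensusUnr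
  (token_kappa ncard_levelSetDep_zero ncard_levelSetDep_offDiag ncard_levelSetDep_diag_low)
open Summit.HodgeConjecture.HodgeConjecture.Cruxes.H413.F0P3cDyRamToricLevelCensusRamKAtThirdField (exists_thirdFieldPackage_ramK)
open Summit.HodgeConjecture.HodgeConjecture.Cruxes.H413.F0P3cDyRamToricCensusSumRamK (toricCensusSum_ramK)

variable {K : Type} [Field K] [Valued K ℤᵐ⁰] {ρ Θ : K →+* K} {α ϖE : K}
variable {K' : Type} [Field K'] [Valued K' ℤᵐ⁰] {σ' : K' →+* K'} {α' π' : K'}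

/-! ## §1 Two BIT-letter lemmas in the two-field frame -/

/-- **AT A DEPTH `c ≤ D` ONE OF THE TWO LINE MODELS IS ALIVE**: two-field RamK frame; `h` hyperbolic, `h′` anisotropic; token `μ = λ − u`; for `1 ≤ c` with
`c + d ≤ jλ + 1`: `BIT(h, μ, c) ∨ BIT(h′, μ, c)` (part 1: one unit `z`, TOP(z,c) ⟸ `c + d ≤ jλ + 1`; part 2: TOP ⇒ ALIVE(z) ∨ ALIVE(z·n₀), dichotomy ★).
[cite: Serre1979, Ch. V §3 Prop. 5, Cor. 3] [cite: Flicker1998UnitaryFL, Prop. 7 p. 84] -/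
theorem topBit_or_topBit_of_le [CompleteSpace K] [Finite 𝓀[K]] [CompleteSpace K'] [Finite 𝓀[K']]
    (hρρ : ∀ x, ρ (ρ x) = x) (hvρ : ∀ x, Valued.v (ρ x) = Valued.v x) (hΘρ : ∀ x, Θ (ρ x) = ρ (Θ x))
    {d t : ℕ} (hD : IsRamifiedQuadraticDatum Θ ϖE d t) (hρϖ : ρ ϖE = ϖE)
    (hα'1 : Valued.v α' ≤ 1) (hα' : Valued.v (α' - σ' α') = 1)
    (jK : K' →+* K) (hjv : ∀ x, Valued.v (jK x) = Valued.v x ^ 2) (hjΘ : ∀ x, Θ (jK x) = jK x) (hjσ : ∀ x, jK (σ' x) = ρ (jK x))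
    {h h' : K} (hΘh : Θ h = h) (hh : h ≠ 0) (hhyper : ∃ x : K, x ≠ 0 ∧ h * Θ x * x + ρ (h * Θ x * x) = 0)
    (hΘh' : Θ h' = h') (hh' : h' ≠ 0) (haniso : ¬ ∃ x : K, x ≠ 0 ∧ h' * Θ x * x + ρ (h' * Θ x * x) = 0)
    {lam u : K} (hlam : lam * Θ lam = 1) (hu : ρ u = u) (hu1 : u * Θ u = 1)
    {m jl : ℕ} (hm : Valued.v (lam - u) = exp (-(m : ℤ))) (hjl : Valued.v ((lam - u) - ρ (lam - u)) = exp (-(jl : ℤ)))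
    {c : ℕ} (hc : 1 ≤ c) (hcd : c + d ≤ jl + 1) :
    (∃ ω₁ : Kˣ, Valued.v (ω₁ : K) = 1 ∧
        Valued.v (1 + ρ h / h / (ρ (lam - u) / (lam - u)) * (ρ ((ω₁ : K) * Θ ω₁) / ((ω₁ : K) * Θ ω₁))) ≤ exp (-(c : ℤ))) ∨
      ∃ ω₁ : Kˣ, Valued.v (ω₁ : K) = 1 ∧
        Valued.v (1 + ρ h' / h' / (ρ (lam - u) / (lam - u)) * (ρ ((ω₁ : K) * Θ ω₁) / ((ω₁ : K) * Θ ω₁))) ≤ exp (-(c : ℤ)) := by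
  have hΘΘ : ∀ x, Θ (Θ x) = x := hD.1
  have hvΘ : ∀ x, Valued.v (Θ x) = Valued.v x := hD.2.1
  have hϖE : Valued.v ϖE = exp (-1 : ℤ) := hD.2.2.1
  have hΘev : ∀ x : K, Θ x = x → x ≠ 0 → ∃ n : ℤ, Valued.v x = exp (2 * n) := hD.2.2.2.1
  have hdatum : Valued.v (ϖE - Θ ϖE) = Valued.v ϖE ^ d := hD.2.2.2.2.1
  haveI : IsAdicComplete 𝓂[K] 𝒪[K] := Literature.NumberTheory.LocalFields.isAdicComplete_valuedInteger_of_completeSpace hϖE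
  have hΘαK : Θ (jK α') = jK α' := hjΘ α'
  have hαK1 : Valued.v (jK α') ≤ 1 := by rw [hjv]; exact pow_le_one' hα'1 _
  have hαKρ : Valued.v (jK α' - ρ (jK α')) = 1 := by rw [← hjσ, ← map_sub, hjv, hα', one_pow]
  obtain ⟨-, -, -, hκΘ, -⟩ := token_kappa hρρ hvρ hΘρ hvΘ hlam hu hu1 hm hjl
  have hμ0 : lam - u ≠ 0 := fun h0 => by rw [h0, map_zero] at hm; exact (exp_ne_zero hm.symm).elim
  obtain ⟨z, n₀, hz1, hκz, hΘn, hn1, hnn, hBz, hBz'⟩ :=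
    exists_unit_of_lineModels hρρ hΘΘ hΘρ hvρ hvΘ hϖE hρϖ hΘev hαK1 hαKρ hΘh hh hhyper hΘh' hh' haniso hμ0
  have hdich := exists_unit_norm_dichotomy_of_isRamifiedQuadraticDatum Θ ϖE d t hD
  have htop := (exists_topDecomp_iff_le hρρ hΘΘ hΘρ hvρ hvΘ hϖE hρϖ hdatum hΘev hΘαK hαK1 hαKρ hz1 hκz hκΘ hc).2 hcd
  rcases alive_or_alive_mul_of_topDecomp (ρ := ρ) hvΘ hdich hΘn hn1 hnn htop with hP | hM
  · exact Or.inl ((hBz c hc).2 hP)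
  · exact Or.inr ((hBz' c hc).2 hM)

/-- **THE `ε = −1` WINDOW from a dead hyperbolic far cell**: two-field RamK frame, `h` hyperbolic, `h′` anisotropic, token `μ = λ − u`; if at some FAR depth `c₀`
(`2d ≤ c₀ + 1`) with `c₀ + d ≤ jλ + 1` the hyperbolic bit `BIT(h, μ, c₀)` is FALSE, then `jλ + 2 ≤ m + 2d` — otherwise `2d ≤ ℓ + 1` (`ℓ = jλ − m`) and ★ p857848 §2
`topBit_hyper_of_topBit_of_two_mul_le` (applied to `H := h·N(ω₀)`, `ρH = −H`, ★ translator + `topBit_mul_norm_iff`) would revive it from the anisotropic bit (§1 above).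
This is the `hε` window of ★ p857635. [cite: Serre1979, Ch. V §3 Cor. 3] [cite: Flicker1998UnitaryFL, p. 84] -/
theorem add_le_of_not_topBit_far [CompleteSpace K] [Finite 𝓀[K]] [CompleteSpace K'] [Finite 𝓀[K']]
    (hρρ : ∀ x, ρ (ρ x) = x) (hvρ : ∀ x, Valued.v (ρ x) = Valued.v x) (hΘρ : ∀ x, Θ (ρ x) = ρ (Θ x))
    {d t : ℕ} (hD : IsRamifiedQuadraticDatum Θ ϖE d t) (hρϖ : ρ ϖE = ϖE)
    (hσ' : ∀ x, σ' (σ' x) = x) (hvσ' : ∀ x, Valued.v (σ' x) = Valued.v x) (hα'1 : Valued.v α' ≤ 1) (hα' : Valued.v (α' - σ' α') = 1)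
    (hπ' : Valued.v π' = exp (-1 : ℤ))
    (jK : K' →+* K) (hjv : ∀ x, Valued.v (jK x) = Valued.v x ^ 2) (hjΘ : ∀ x, Θ (jK x) = jK x) (hjfix : ∀ z : K, Θ z = z → ∃ x, jK x = z)
    (hjσ : ∀ x, jK (σ' x) = ρ (jK x))
    {h h' : K} (hΘh : Θ h = h) (hh : h ≠ 0) (hhyper : ∃ x : K, x ≠ 0 ∧ h * Θ x * x + ρ (h * Θ x * x) = 0)
    (hΘh' : Θ h' = h') (hh' : h' ≠ 0) (haniso : ¬ ∃ x : K, x ≠ 0 ∧ h' * Θ x * x + ρ (h' * Θ x * x) = 0)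
    {lam u : K} (hlam : lam * Θ lam = 1) (hu : ρ u = u) (hu1 : u * Θ u = 1)
    {m jl : ℕ} (hm : Valued.v (lam - u) = exp (-(m : ℤ))) (hjl : Valued.v ((lam - u) - ρ (lam - u)) = exp (-(jl : ℤ)))
    {c₀ : ℕ} (hc₀far : 2 * d ≤ c₀ + 1) (hc₀D : c₀ + d ≤ jl + 1)
    (hnot : ¬ ∃ ω₁ : Kˣ, Valued.v (ω₁ : K) = 1 ∧
        Valued.v (1 + ρ h / h / (ρ (lam - u) / (lam - u)) * (ρ ((ω₁ : K) * Θ ω₁) / ((ω₁ : K) * Θ ω₁))) ≤ exp (-(c₀ : ℤ))) :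
    jl + 2 ≤ m + 2 * d := by
  have hΘΘ : ∀ x, Θ (Θ x) = x := hD.1
  have hvΘ : ∀ x, Valued.v (Θ x) = Valued.v x := hD.2.1
  have hϖE : Valued.v ϖE = exp (-1 : ℤ) := hD.2.2.1
  have hΘev : ∀ x : K, Θ x = x → x ≠ 0 → ∃ n : ℤ, Valued.v x = exp (2 * n) := hD.2.2.2.1
  have hd1 : 1 ≤ d := hD.2.2.2.2.2.1
  have hρΘ : ∀ x, ρ (Θ x) = Θ (ρ x) := fun x => (hΘρ x).symm
  haveI : IsAdicComplete 𝓂[K] 𝒪[K] := Literature.NumberTheory.LocalFields.isAdicComplete_valuedInteger_of_completeSpace hϖE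
  have hϖ0 : ϖE ≠ 0 := (v_varpi_zpow hϖE 0).1
  have hΘαK : Θ (jK α') = jK α' := hjΘ α'
  have hαK1 : Valued.v (jK α') ≤ 1 := by rw [hjv]; exact pow_le_one' hα'1 _
  have hαKρ : Valued.v (jK α' - ρ (jK α')) = 1 := by rw [← hjσ, ← map_sub, hjv, hα', one_pow]
  have hαne : jK α' - ρ (jK α') ≠ 0 := fun h0 => by rw [h0, map_zero] at hαKρ; exact zero_ne_one hαKρ
  obtain ⟨-, -, -, -, hmjl⟩ := token_kappa hρρ hvρ hΘρ hvΘ hlam hu hu1 hm hjl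
  have hμ0 : lam - u ≠ 0 := fun h0 => by rw [h0, map_zero] at hm; exact (exp_ne_zero hm.symm).elim
  by_contra hwin
  -- the other line model is alive at `c₀`
  have hc₀ : 1 ≤ c₀ := by omega
  have hbit' := (topBit_or_topBit_of_le hρρ hvρ hΘρ hD hρϖ hα'1 hα' jK hjv hjΘ hjσ hΘh hh hhyper hΘh' hh' haniso hlam hu hu1 hm hjl hc₀ hc₀D).resolve_left hnot
  -- the anti-fixed normal form `H := h·N(ω₀)` and the two (D3) units
  obtain ⟨ω₀, hω₀, hη⟩ := exists_unit_twist_eq_of_isotropic hΘρ hϖE hρϖ hh hhyper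
  have hN₀0 : (ω₀ : K) * Θ ω₀ ≠ 0 := mul_ne_zero ω₀.ne_zero ((map_ne_zero Θ).2 ω₀.ne_zero)
  have hΘH : Θ (h * ((ω₀ : K) * Θ ω₀)) = h * ((ω₀ : K) * Θ ω₀) := by rw [map_mul, map_mul, hΘΘ, hΘh, mul_comm (Θ (ω₀ : K))]
  have hH0 : h * ((ω₀ : K) * Θ ω₀) ≠ 0 := mul_ne_zero hh hN₀0
  have hρH : ρ (h * ((ω₀ : K) * Θ ω₀)) = -(h * ((ω₀ : K) * Θ ω₀)) := by
    have := hη; field_simp at this; rw [map_mul]; linear_combination this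
  obtain ⟨n, z, hz1, hPeq⟩ := exists_eq_varpi_zpow_mul_unit hϖE (mul_ne_zero (mul_ne_zero hμ0 hH0) hαne)
  obtain ⟨n', z', hz'1, hP'eq⟩ := exists_eq_varpi_zpow_mul_unit hϖE (mul_ne_zero (mul_ne_zero hμ0 hh') hαne)
  -- the norm suppliers
  have hNF : ∀ f : K, ρ f = f → Θ f = f → Valued.v f = 1 → ∃ x : K, x * Θ x = f := fun f hρf hΘf hf =>
    exists_mul_map_eq_of_fixed_fixed_of_thirdField hρρ hvρ hΘρ hD hσ' hvσ' hα'1 hα' hπ' jK hjv hjΘ hjfix hjσ hρf hΘf hf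
  have hNd : ∀ u : K, Θ u = u → Valued.v (u - 1) ≤ Valued.v ϖE ^ (2 * d) → ∃ x : K, x * Θ x = u := fun u hΘu hu =>
    let ⟨x, hx, _⟩ := exists_mul_map_eq_of_isRamifiedQuadraticDatum Θ ϖE d t hD u hΘu hu
    ⟨x, hx⟩
  -- `|μ − ρμ| = exp(−(ℓ + m))` with `ℓ := jl − m ≥ 2d − 1`
  have hμρ : Valued.v ((lam - u) - ρ (lam - u)) = exp (-(((jl - m : ℕ) : ℤ) + m)) := by rw [hjl]; congr 1; omega
  have hdℓ : 2 * d ≤ (jl - m) + 1 := by omega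
  have hrevive := F0P3cDyRamTopBitNormBridge.topBit_hyper_of_topBit_of_two_mul_le hρρ hΘΘ hρΘ hvρ hvΘ hϖE hρϖ hΘev hαK1 hαKρ hΘαK hαK1 hαKρ hd1 hNF hNd
    hm hμρ hdℓ hΘH hρH hH0 hΘh' hh' (by rw [map_zpow₀, hρϖ]) (zpow_ne_zero n hϖ0) (by rw [map_zpow₀, hρϖ]) (zpow_ne_zero n' hϖ0) hPeq hz1 hP'eq hz'1 hc₀ hbit'
  exact hnot ((topBit_mul_norm_iff (Θ := Θ) h (lam - u) ω₀ hω₀ (exp (-(c₀ : ℤ)))).1 hrevive)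

/-! ## §2 The weld -/

/-- **THE T5s WELD ON TYPE RamK** (socket (B), (B-2)).  In the one-field frame of ★ p857929 (`M = K` complete, DVR integers, residue field of size `q²`; `ρ, Θ` commuting;
`α` integral with `|α − ρα| = 1`; the ramified `Θ`-datum on the `ρ`-fixed uniformiser `ϖE`; `Θ` residually trivial on `Fix ρ`; the RamK case-definer `|α − Θα| < 1`), for a
HYPERBOLIC scalar `h`, an ANISOTROPIC scalar `h′` (both `Θ`-fixed), the token `μ = λ − u` (`λΘλ = 1`, `ρu = u`, `uΘu = 1`, `|μ| = exp(−m)`, `|μ − ρμ| = exp(−jλ)`), the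
token-side facts `2 ≤ d`, `3d ≤ jλ + 2 + 2(d%2)`, `m ≡ d (2)`, `d − d%2 ≤ m + 1`, and a side letter `ε ∈ {±1}` agreeing with the hyperbolic bit at some far depth `c₀ ≤ D` when
far cells exist: `ε·Σ_{j < jλ+1} Σ_{a < jλ+2} q^a·(#levelSetDep_h(j,a;μ) − #levelSetDep_{h′}(j,a;μ)) = q^m·(2·Σ_{i < (jλ−d)∕2+1} q^i − 2·Σ_{i < d − d%2} q^i)`.
[cite: Kottwitz1986BaseChangeUnits, §1 pp. 240–241] [cite: Rogawski1990, §4.9 Prop. 4.9.1 (b) p. 55, Lemma 4.9.3 p. 56] [cite: Flicker1998UnitaryFL, Prop. 7 p. 84] -/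
theorem toricCensusSum_ramK_weld [CompleteSpace K] [IsDiscreteValuationRing 𝒪[K]] [Finite 𝓀[K]]
    (hρρ : ∀ x, ρ (ρ x) = x) (hvρ : ∀ x, Valued.v (ρ x) = Valued.v x) (hΘρ : ∀ x, Θ (ρ x) = ρ (Θ x))
    (hα1 : Valued.v α ≤ 1) (hα : Valued.v (α - ρ α) = 1) {d t : ℕ} (hD : IsRamifiedQuadraticDatum Θ ϖE d t) (hρϖ : ρ ϖE = ϖE)
    {q : ℕ} (hq : Nat.card 𝓀[K] = q ^ 2)
    (hσres : ∀ z : K, ρ z = z → Valued.v z ≤ 1 → Valued.v (Θ z - z) < 1) (hram : Valued.v (α - Θ α) < 1)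
    {h h' : K} (hΘh : Θ h = h) (hh : h ≠ 0) (hhyper : ∃ x : K, x ≠ 0 ∧ h * Θ x * x + ρ (h * Θ x * x) = 0)
    (hΘh' : Θ h' = h') (hh' : h' ≠ 0) (haniso : ¬ ∃ x : K, x ≠ 0 ∧ h' * Θ x * x + ρ (h' * Θ x * x) = 0)
    {lam u : K} (hlam : lam * Θ lam = 1) (hu : ρ u = u) (hu1 : u * Θ u = 1)
    {m jl : ℕ} (hm : Valued.v (lam - u) = exp (-(m : ℤ))) (hjl : Valued.v ((lam - u) - ρ (lam - u)) = exp (-(jl : ℤ)))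
    (hd2 : 2 ≤ d) (hjlS : 3 * d ≤ jl + 2 + 2 * (d % 2)) (hmpar : m % 2 = d % 2) (hmS : d - d % 2 ≤ m + 1)
    (ε : ℚ) (hε1 : ε = 1 ∨ ε = -1)
    (hside : 3 * d ≤ jl + 2 → ∃ c₀ : ℕ, 2 * d ≤ c₀ + 1 ∧ c₀ + d ≤ jl + 1 ∧
      (ε = 1 ↔ ∃ ω₁ : Kˣ, Valued.v (ω₁ : K) = 1 ∧
        Valued.v (1 + ρ h / h / (ρ (lam - u) / (lam - u)) * (ρ ((ω₁ : K) * Θ ω₁) / ((ω₁ : K) * Θ ω₁))) ≤ exp (-(c₀ : ℤ)))) :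
    ε * ∑ j ∈ range (jl + 1), ∑ a ∈ range (jl + 2), (q : ℚ) ^ a *
        (((levelSetDep ρ Θ α ϖE h j a (lam - u)).ncard : ℚ) - ((levelSetDep ρ Θ α ϖE h' j a (lam - u)).ncard : ℚ)) =
      (q : ℚ) ^ m * (2 * ∑ i ∈ range ((jl - d) / 2 + 1), (q : ℚ) ^ i - 2 * ∑ i ∈ range (d - d % 2), (q : ℚ) ^ i) := by
  classical
  -- ## the datum's clauses and the third field
  have hΘΘ : ∀ x, Θ (Θ x) = x := hD.1
  have hvΘ : ∀ x, Valued.v (Θ x) = Valued.v x := hD.2.1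
  have hϖE : Valued.v ϖE = exp (-1 : ℤ) := hD.2.2.1
  have hΘev : ∀ x : K, Θ x = x → x ≠ 0 → ∃ n : ℤ, Valued.v x = exp (2 * n) := hD.2.2.2.1
  have hdatum : Valued.v (ϖE - Θ ϖE) = Valued.v ϖE ^ d := hD.2.2.2.2.1
  obtain ⟨K', _, _, σ', α', π', jK, hDVR, hfin, hcs, hσ', hvσ', hα'1, hα', hπ', hq', hjv, hjΘ, hjfix, hjσ⟩ :=
    exists_thirdFieldPackage_ramK hρρ hvρ hΘρ hα1 hα hD hq hσres hram
  haveI := hDVR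
  haveI := hfin
  haveI := hcs
  -- ## token bookkeeping
  obtain ⟨-, -, -, hκΘ, hmjl⟩ := token_kappa hρρ hvρ hΘρ hvΘ hlam hu hu1 hm hjl
  have hjlpar : jl % 2 = d % 2 := mod_two_eq_of_v_sub_map_eq hΘΘ hϖE hdatum hΘev hκΘ
  have hmjlpar : m % 2 = jl % 2 := by rw [hmpar, hjlpar]
  have hq2 : 2 ≤ q := by
    have h1 : 1 < Nat.card 𝓀[K] := Finite.one_lt_card
    rw [hq] at h1
    by_contra hlt
    interval_cases q <;> simp at h1
  have hε : ε = 1 ∨ (ε = -1 ∧ jl + 2 ≤ m + 2 * d) := by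
    rcases hε1 with h1 | h1
    · exact Or.inl h1
    · refine Or.inr ⟨h1, ?_⟩
      by_cases hfar : 3 * d ≤ jl + 2
      · obtain ⟨c₀, hc₀far, hc₀D, hSc₀⟩ := hside hfar
        have hnot : ¬ ∃ ω₁ : Kˣ, Valued.v (ω₁ : K) = 1 ∧
            Valued.v (1 + ρ h / h / (ρ (lam - u) / (lam - u)) * (ρ ((ω₁ : K) * Θ ω₁) / ((ω₁ : K) * Θ ω₁))) ≤ exp (-(c₀ : ℤ)) :=
          fun hb => by have := hSc₀.2 hb; rw [h1] at this; norm_num at this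
        exact add_le_of_not_topBit_far hρρ hvρ hΘρ hD hρϖ hσ' hvσ' hα'1 hα' hπ' jK hjv hjΘ hjfix hjσ hΘh hh hhyper hΘh' hh' haniso
          hlam hu hu1 hm hjl hc₀far hc₀D hnot
      · omega
  -- ## the ★ heads, abbreviated
  have HP := fun j a => ncard_levelSet_ramK_hyper hρρ hvρ hΘρ hα1 hα hD hρϖ hΘh hh hq hσ' hvσ' hα'1 hα' hπ' hq' jK hjv hjΘ hjfix hjσ hhyper j a
  have HM := fun j a => ncard_levelSet_ramK_aniso hρρ hvρ hΘρ hα1 hα hD hρϖ hΘh' hh' hq hσ' hvσ' hα'1 hα' hπ' hq' jK hjv hjΘ hjfix hjσ haniso j a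
  have HT : ∀ j a, j ≤ jl → 1 ≤ a → j + m = jl + a → m + 1 ≤ 2 * a → _ := fun j a hj ha hdiag htop =>
    ncard_levelSetDep_top_ramK_eq hρρ hvρ hΘρ hα1 hα hD hρϖ hq hσ' hvσ' hα'1 hα' hπ' hq' jK hjv hjΘ hjfix hjσ hΘh hh hhyper hΘh' hh' haniso
      hlam hu hu1 hm hjl hmjlpar hd2 (S := ε = 1) hside hj ha hdiag htop
  -- ## the tables
  obtain ⟨nP, hnPdef⟩ : ∃ f : ℕ → ℕ → ℚ, f = fun j a => ((levelSet ρ Θ α ϖE h j a).ncard : ℚ) := ⟨_, rfl⟩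
  obtain ⟨nM, hnMdef⟩ : ∃ f : ℕ → ℕ → ℚ, f = fun j a => ((levelSet ρ Θ α ϖE h' j a).ncard : ℚ) := ⟨_, rfl⟩
  obtain ⟨vP, hvPdef⟩ : ∃ f : ℕ → ℕ → ℚ, f = fun j a => if j ≤ jl then ((levelSetDep ρ Θ α ϖE h j a (lam - u)).ncard : ℚ) else 0 := ⟨_, rfl⟩
  obtain ⟨vM, hvMdef⟩ : ∃ f : ℕ → ℕ → ℚ, f = fun j a => if j ≤ jl then ((levelSetDep ρ Θ α ϖE h' j a (lam - u)).ncard : ℚ) else 0 := ⟨_, rfl⟩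
  -- (1) the u-free tables
  have hnP : ∀ j a, nP j a = ((if j = 0 then (if a = 0 then 1 else 0) else if j < a ∨ (j - a) % 2 = 1 then 0
      else if a = j then (if 2 ≤ d then q ^ j else (q - 1) * q ^ (j - 1)) else if a = 0 then (if 2 * d ≤ j + 1 then 2 else 1) * q ^ (j / 2)
      else if j - a + 2 < 2 * d then (q - 1) * q ^ (j - 1 - (j - a) / 2) else if j - a + 2 = 2 * d then (q - 2) * q ^ (j - d)
      else 2 * (q - 1) * q ^ (j - 1 - (j - a) / 2) : ℕ) : ℚ) := fun j a => by rw [hnPdef]; dsimp only; rw [HP j a]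
  have hnM : ∀ j a, nM j a = ((if j = 0 then (if a = 0 then 1 else 0) else if j < a ∨ (j - a) % 2 = 1 then 0
      else if a = j then (if 2 ≤ d then q ^ j else (q + 1) * q ^ (j - 1)) else if a = 0 then (if j + 2 ≤ 2 * d then q ^ (j / 2) else 0)
      else if j - a + 2 < 2 * d then (q - 1) * q ^ (j - 1 - (j - a) / 2) else if j - a + 2 = 2 * d then q ^ (j - d + 1) else 0 : ℕ) : ℚ) :=
    fun j a => by rw [hnMdef]; dsimp only; rw [HM j a]
  -- empty u-free cells for `j < a`
  have hnP0 : ∀ j a, j < a → nP j a = 0 := fun j a hja => by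
    rw [hnP]; split_ifs <;> first | rfl | (exfalso; omega)
  have hnM0 : ∀ j a, j < a → nM j a = 0 := fun j a hja => by
    rw [hnM]; split_ifs <;> first | rfl | (exfalso; omega)
  -- (2) `hvGen`
  have hvGen : ∀ j a, (a ≤ m ∧ (j + a ≤ m ∨ (2 * a ≤ m ∧ j + a ≤ jl))) → vP j a = nP j a ∧ vM j a = nM j a := by
    intro j a hgen
    have hj : j ≤ jl := by omega
    rw [hvPdef, hvMdef, hnPdef, hnMdef]; dsimp only; rw [if_pos hj, if_pos hj]
    rcases Nat.eq_zero_or_pos a with rfl | ha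
    · rw [ncard_levelSetDep_zero hρρ hvρ hΘΘ hΘρ hvΘ hα1 hα hρϖ hϖE hh hm hjl hj,
        ncard_levelSetDep_zero hρρ hvρ hΘΘ hΘρ hvΘ hα1 hα hρϖ hϖE hh' hm hjl hj]
      exact ⟨rfl, rfl⟩
    · by_cases hdiag : j + m = jl + a
      · rw [ncard_levelSetDep_diag_low hρρ hvρ hΘΘ hΘρ hvΘ hα1 hα hρϖ hϖE hh hm hjl ha hdiag (by omega),
          ncard_levelSetDep_diag_low hρρ hvρ hΘΘ hΘρ hvΘ hα1 hα hρϖ hϖE hh' hm hjl ha hdiag (by omega)]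
        exact ⟨rfl, rfl⟩
      · rw [ncard_levelSetDep_offDiag hρρ hvρ hΘΘ hΘρ hvΘ hα1 hα hρϖ hϖE hh hm hjl ha hdiag,
          ncard_levelSetDep_offDiag hρρ hvρ hΘΘ hΘρ hvΘ hα1 hα hρϖ hϖE hh' hm hjl ha hdiag]
        by_cases hP : 2 * a ≤ m ∧ (j + a ≤ m ∨ j + a ≤ jl)
        · rw [if_pos hP, if_pos hP]; exact ⟨rfl, rfl⟩
        · have hja : j < a := by omega
          have h1 := hnP0 j a hja
          have h2 := hnM0 j a hja
          rw [hnPdef] at h1; rw [hnMdef] at h2; dsimp only at h1 h2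
          rw [if_neg hP, if_neg hP, Nat.cast_zero, h1, h2]
          exact ⟨rfl, rfl⟩
  -- (3) `hvOff`
  have hvOff : ∀ j a, ¬ (a ≤ m ∧ (j + a ≤ m ∨ (2 * a ≤ m ∧ j + a ≤ jl))) → j + m ≠ jl + a → vP j a = 0 ∧ vM j a = 0 := by
    intro j a hgen hoff
    rw [hvPdef, hvMdef]; dsimp only
    by_cases hj : j ≤ jl
    · rw [if_pos hj, if_pos hj]
      have ha : 1 ≤ a := by
        by_contra h0
        exact hgen ⟨by omega, Or.inr ⟨by omega, by omega⟩⟩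
      rw [ncard_levelSetDep_offDiag hρρ hvρ hΘΘ hΘρ hvΘ hα1 hα hρϖ hϖE hh hm hjl ha hoff,
        ncard_levelSetDep_offDiag hρρ hvρ hΘΘ hΘρ hvΘ hα1 hα hρϖ hϖE hh' hm hjl ha hoff]
      have hP : ¬ (2 * a ≤ m ∧ (j + a ≤ m ∨ j + a ≤ jl)) := fun hP => hgen ⟨by omega, by omega⟩
      rw [if_neg hP, if_neg hP, Nat.cast_zero]
      exact ⟨rfl, rfl⟩
    · rw [if_neg hj, if_neg hj]; exact ⟨rfl, rfl⟩
  -- (4) `hvTop`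
  have hvTop : ∀ j a, ¬ (a ≤ m ∧ (j + a ≤ m ∨ (2 * a ≤ m ∧ j + a ≤ jl))) → j + m = jl + a →
      (vP j a = if 2 * j + d ≤ 2 * jl + 1 ∧ (j + a + 2 ≤ m + 2 * d ∨ ε = 1) then (if j + a + 2 ≤ m + 2 * d then 1 else 2) * (q : ℚ) ^ (j - (j + a - m + 1) / 2) else 0) ∧
      (vM j a = if 2 * j + d ≤ 2 * jl + 1 ∧ (j + a + 2 ≤ m + 2 * d ∨ ε = -1) then (if j + a + 2 ≤ m + 2 * d then 1 else 2) * (q : ℚ) ^ (j - (j + a - m + 1) / 2) else 0) := by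
    intro j a hgen hdiag
    rw [hvPdef, hvMdef]; dsimp only
    by_cases hj : j ≤ jl
    · have ha : 1 ≤ a := by
        by_contra h0
        exact hgen ⟨by omega, Or.inr ⟨by omega, by omega⟩⟩
      have htop : m + 1 ≤ 2 * a := by
        by_contra hlow
        exact hgen ⟨by omega, Or.inr ⟨by omega, by omega⟩⟩
      obtain ⟨HTP, HTM⟩ := HT j a hj ha hdiag htop
      rw [if_pos hj, if_pos hj, HTP, HTM]
      have hneg : (¬ ε = 1) ↔ ε = -1 := by
        rcases hε1 with h1 | h1
        · rw [h1]; norm_num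
        · rw [h1]; norm_num
      constructor
      · push_cast; rfl
      · push_cast
        by_cases hc : 2 * j + d ≤ 2 * jl + 1 ∧ (j + a + 2 ≤ m + 2 * d ∨ ε = -1)
        · rw [if_pos hc, if_pos (⟨hc.1, hc.2.imp id hneg.2⟩ : 2 * j + d ≤ 2 * jl + 1 ∧ (j + a + 2 ≤ m + 2 * d ∨ ¬ ε = 1))]
        · rw [if_neg hc, if_neg (fun h0 => hc ⟨h0.1, h0.2.imp id hneg.1⟩)]
    · have hfalse : ¬ (2 * j + d ≤ 2 * jl + 1 ∧ (j + a + 2 ≤ m + 2 * d ∨ ε = 1)) := fun h0 => by omega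
      have hfalse' : ¬ (2 * j + d ≤ 2 * jl + 1 ∧ (j + a + 2 ≤ m + 2 * d ∨ ε = -1)) := fun h0 => by omega
      rw [if_neg hj, if_neg hj, if_neg hfalse, if_neg hfalse']
      exact ⟨rfl, rfl⟩
  -- ## the ★ T5s identity, then unfold the tables on `j ≤ jλ`
  have key := toricCensusSum_ramK q ε hq2 hd2 hjlpar hjlS hmpar hmS hmjl hε nP nM vP vM hnP hnM hvGen hvOff hvTop
  rw [← key]
  congr 1
  refine sum_congr rfl fun j hj => sum_congr rfl fun a _ => ?_
  have hj' : j ≤ jl := by rw [mem_range] at hj; omega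
  rw [hvPdef, hvMdef]; dsimp only; rw [if_pos hj', if_pos hj']

end Summit.HodgeConjecture.HodgeConjecture.Cruxes.H413.F0P3cDyRamToricLevelCensusRamK
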